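import Summits.ValiantsHypothesis.ValiantsHypothesis.Theorems.VPBoundarySquareBinaryFormat
import Summits.ValiantsHypothesis.ValiantsHypothesis.Theorems.VPBoundarySquareCaseSplit
import Literature.Computability.AlgebraicComplexity.BurgisserBooleanPartsA3Assembly
import HarnessLib

/-!
# The boundary square of `VP`: `VNP^ℂ ⊆ FORMAT` — binary skeletons are `VNP`-blind

Route `VPBoundarySquare`, rider §4 of the binary normal form (F1 =
`VPBoundarySquareBinaryFormat`).  Every `VNPnb` (a fortiori `VNP`, `VP`) p-family over `ℂ` has a
FORMAT skeleton: it is the Boolean sum of a renamed integer GENERIC COMPUTATION `G_{t(n)}`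
specialised at polynomially many constants [Burgisser2024Completeness, §4.2], and an integer
family computed by p-size constant-free fan-in-two circuits, Boolean-summed over `u(n)` bits, has
degree `≤ 2^size` and coefficients `≤ 2^u · 2^(2^size)` [Burgisser2000TCS, Lemma 2.4] — the
format half of `VNPnb⁰ ⊆ VCH⁰` [Burgisser2026HNC, Cor. 4.10], unconditionally.  By F1 it then
has a BINARY skeleton on polynomially many slots.  So the format / binary invariants cannot
separate `\overline{VP}` from `VNP`: a border p-family WITHOUT binary skeleton refutes
`U = ClosureDefinable`, hence proves `M = BoundaryOfVPNonempty` and the residual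
`Q = EmptyBoundarySeparates` (compositions with `VPBoundarySquareCaseSplit`).  Decision of record:
height / format is not an axis of R1.  Theorem-only: no definitions, no named facts.
-/

open MvPolynomial
open Literature.Computability.AlgebraicComplexity

namespace Summit.ValiantsHypothesis.ValiantsHypothesis.Theorems.VPBoundarySquareBinaryFormatVNP

open Summit.ValiantsHypothesis.ValiantsHypothesis.Theses.VPBoundarySquare
open Summit.ValiantsHypothesis.ValiantsHypothesis.Theorems.VPBoundarySquareBinaryFormat
open Summit.ValiantsHypothesis.ValiantsHypothesis.Theorems.VPBoundarySquareCompletionLadder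
open Summit.ValiantsHypothesis.ValiantsHypothesis.Theorems.VPBoundarySquareCaseSplit

variable {v : ℕ → ℕ}

/-! ## §4a Integer level: Boolean sums of `VPnb⁰` families have exponential format -/
/-- `|coeff_d F| ≤ wt(F)`. [cite: Burgisser2000TCS, §2 (p. 76)] -/
theorem coeffNatAbs_le_weight {σ : Type*} (F : MvPolynomial σ ℤ) (d : σ →₀ ℕ) :
    (coeff d F).natAbs ≤ weight F := by
  classical
  by_cases hd : coeff d F = 0
  · simp [hd]
  · exact Finset.single_le_sum (f := fun m => (coeff m F).natAbs) (fun _ _ => Nat.zero_le _)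
      (mem_support_iff.2 hd)

/-- **`VNPnb⁰ ⊆ FORMAT`, unconditionally** (the format half of `VNPnb⁰ ⊆ VCH⁰`): the Boolean
sum over `u(n)` bits of an integer family computed by p-size constant-free fan-in-two circuits
has degree `≤ 2^size` and coefficients of absolute value `≤ 2^u · 2^(2^size)`.
[cite: Burgisser2000TCS, Lemma 2.4 (p. 77)] [cite: Burgisser2026HNC, Cor. 4.10 (p. 13)] -/
theorem isExpFormat_boolSum {m u : ℕ → ℕ} {g : ∀ n, MvPolynomial (Fin (m n) ⊕ Fin (u n)) ℤ}
    (hg : IsVPnb0Family g) : IsExpFormat fun n => boolSum (g n) := by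
  classical
  obtain ⟨hcard, P, hP, hsize⟩ := hg
  have hm : IsPBounded m := hcard.mono fun n => by simp [Fintype.card_sum, Fintype.card_fin]
  have hu : IsPBounded u := hcard.mono fun n => by simp [Fintype.card_sum, Fintype.card_fin]
  refine ⟨fun n => m n + u n + (P n).size + 1, IsPBounded.add_holds (IsPBounded.add_holds
    (IsPBounded.add_holds hm hu) hsize) (IsPBounded.const 1), fun n => ?_⟩
  have hPg : (P n).eval = g n := (hP n).2.2
  have h0 : m n ≤ m n + u n + (P n).size + 1 := by omega
  have hdeg : (boolSum (g n)).totalDegree ≤ 2 ^ (m n + u n + (P n).size + 1) := by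
    refine (totalDegree_boolSum_le _).trans ?_
    rw [← hPg]
    exact (totalDegree_eval_le_two_pow_size (hP n).1).trans
      (Nat.pow_le_pow_right two_pos (by omega))
  have hwg : weight (g n) ≤ 2 ^ 2 ^ (P n).size := by
    rw [← hPg]
    exact weight_eval_le_two_pow_two_pow_size (hP n).1 (hP n).2.1
  have hθ : ∀ (b : Fin (u n) → Bool) (i : Fin (m n) ⊕ Fin (u n)),
      weight (Sum.elim X (fun j => if b j then (1 : MvPolynomial (Fin (m n)) ℤ) else 0) i)
        ≤ 1 := by
    rintro b (x | j)
    · simp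
    · simp only [Sum.elim_inr]; split_ifs <;> simp
  have hws : weight (boolSum (g n)) ≤ 2 ^ u n * 2 ^ 2 ^ (P n).size := by
    unfold boolSum
    refine (weight_finset_sum_le _ _).trans ?_
    calc ∑ b : Fin (u n) → Bool, weight (aeval (Sum.elim X fun j =>
            if b j then (1 : MvPolynomial (Fin (m n)) ℤ) else 0) (g n))
        ≤ ∑ _b : Fin (u n) → Bool, 2 ^ 2 ^ (P n).size :=
          Finset.sum_le_sum fun b _ =>
            (weight_aeval_le_of_forall_le_one _ (hθ b) (g n)).trans hwg
      _ = 2 ^ u n * 2 ^ 2 ^ (P n).size := by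
          rw [Finset.sum_const, Finset.card_univ, Fintype.card_fun, Fintype.card_bool,
            Fintype.card_fin, smul_eq_mul]
  have h1 : u n < 2 ^ u n := Nat.lt_two_pow_self
  have h2 : 2 ^ u n ≤ 2 ^ (m n + u n + (P n).size) := Nat.pow_le_pow_right two_pos (by omega)
  have h3 : 2 ^ (P n).size ≤ 2 ^ (m n + u n + (P n).size) :=
    Nat.pow_le_pow_right two_pos (by omega)
  have h4 : 2 ^ (m n + u n + (P n).size + 1) = 2 ^ (m n + u n + (P n).size) * 2 :=
    pow_succ _ _
  have h5 : u n + 2 ^ (P n).size < 2 ^ (m n + u n + (P n).size + 1) := by omega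
  have hht : ∀ d, (coeff d (boolSum (g n))).natAbs < 2 ^ 2 ^ (m n + u n + (P n).size + 1) := by
    intro d
    refine ((coeffNatAbs_le_weight _ d).trans hws).trans_lt ?_
    rw [← pow_add]
    exact Nat.pow_lt_pow_right one_lt_two h5
  exact ⟨h0, hdeg, hht⟩

/-! ## §4b `VNPnb^ℂ ⊆ FORMAT`: specialise the Boolean sum of a renamed generic computation -/
/-- **`VNPnb^ℂ ⊆ FORMAT`.** A `VNPnb` family over `ℂ` in the variables `Fin (v n)`, `v`
p-bounded, is the specialisation at polynomially many complex constants of the Boolean sum of the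
renamed integer generic computation `G_{t(n)}` ("obtained from the universal classes by
specializing variables to constants"), a `VPnb⁰` family, hence of exponential format; the
construction of `vchSpec_of_isVNPnbFamily` without the `VCH⁰` fact.
[cite: Burgisser2024Completeness, §4.2 (p0016 L8–L11)] [cite: Burgisser2026HNC, Def. 4.1] -/
theorem formatSkeletons_of_isVNPnbFamily {f : ∀ n, MvPolynomial (Fin (v n)) ℂ}
    (hv : IsPBounded v) (hf : IsVNPnbFamily f) : FormatSkeletons f := by
  classical
  obtain ⟨u, g, hg, hfg⟩ := hf
  have hu : IsPBounded u := hg.1.mono fun n => by simp [Fintype.card_sum, Fintype.card_fin]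
  obtain ⟨-, t, ht, hφ⟩ := (Bur24_sec4_2_isVPnbFamily_iff_specialisation g).1 hg
  choose φ hφv hgφ using hφ
  let w : ℕ → ℕ := fun n => Fintype.card (MalodGeneric.Var (t n))
  let e : ∀ n, MalodGeneric.Var (t n) ≃ Fin (w n) := fun n => Fintype.equivFin _
  obtain ⟨ρ, hρ⟩ : ∃ ρ : ∀ n, MalodGeneric.Var (t n) → Fin (v n + w n) ⊕ Fin (u n), ∀ n i,
      ρ n i = if h : ∃ x, φ n i = X x then Sum.map (Fin.castAdd (w n)) id h.choose
        else Sum.inl (Fin.natAdd (v n) (e n i)) :=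
    ⟨_, fun _ _ => rfl⟩
  obtain ⟨κ, hκ⟩ : ∃ κ : ∀ n, Fin (w n) → ℂ, ∀ n j,
      κ n j = if h : ∃ c, φ n ((e n).symm j) = C c then h.choose else 0 :=
    ⟨_, fun _ _ => rfl⟩
  let θ : ∀ n, Fin (v n + w n) → MvPolynomial (Fin (v n)) ℂ :=
    fun n => Fin.append MvPolynomial.X fun j => MvPolynomial.C (κ n j)
  let Θ : ∀ n, Fin (v n + w n) ⊕ Fin (u n) → MvPolynomial (Fin (v n) ⊕ Fin (u n)) ℂ :=
    fun n => Sum.elim (fun y => rename Sum.inl (θ n y)) fun j => X (Sum.inr j)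
  have hΘX : ∀ n (s : Fin (v n) ⊕ Fin (u n)),
      Θ n (Sum.map (Fin.castAdd (w n)) id s) = X s := by
    rintro n (y | j)
    · simp [Θ, θ, Fin.append_left, rename_X]
    · simp [Θ]
  have hcomp : ∀ n i, Θ n (ρ n i) = φ n i := by
    intro n i
    rw [hρ]
    split_ifs with h
    · rw [hΘX, ← h.choose_spec]
    · rcases hφv n i with hx | ⟨c, hc⟩
      · exact absurd hx h
      · have h' : ∃ c', φ n ((e n).symm (e n i)) = C c' :=
          ⟨c, by rw [Equiv.symm_apply_apply, hc]⟩
        simp only [Θ, θ, Sum.elim_inl, Fin.append_right, rename_C]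
        rw [hκ, dif_pos h']
        calc C h'.choose = φ n ((e n).symm (e n i)) := h'.choose_spec.symm
          _ = φ n i := congrArg (φ n) (Equiv.symm_apply_apply _ _)
  have hG := isVPnb0Family_genericComputation_comp ht
  have hcard : IsPBounded fun n => Fintype.card (Fin (v n + w n) ⊕ Fin (u n)) :=
    (IsPBounded.add_holds (IsPBounded.add_holds hv hG.1) hu).mono fun n => by
      simp [w, Fintype.card_sum, Fintype.card_fin]
  refine ⟨w, fun n => boolSum (rename (ρ n) (MalodGeneric.genericComputation ℤ (t n))), κ,
    isExpFormat_boolSum (m := fun n => v n + w n) (u := u) (hG.rename ρ hcard), fun n => ?_⟩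
  have hfun : (Θ n ∘ ρ n) = φ n := funext fun i => hcomp n i
  rw [hfg n, hgφ n, map_boolSum', MvPolynomial.map_rename, MalodGeneric.map_genericComputation,
    ← boolSum_aeval_extend', MvPolynomial.aeval_rename]
  exact congrArg (fun ψ => boolSum (aeval ψ (MalodGeneric.genericComputation ℂ (t n)))) hfun.symm

/-! ## §4c `VNP^ℂ ⊆ FORMAT = BINARY`, and the compositions `¬BINARY ⟹ ¬U ⟹ M, Q` -/
/-- **`VNP^ℂ ⊆ FORMAT`**: every `VNP` family over `ℂ` has a format skeleton (`VNP ⊆ VNPnb`).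
[cite: Burgisser2024Completeness, §4.2 (p0016 L8–L18)] [cite: Burgisser2026HNC, Def. 4.1] -/
theorem formatSkeletons_of_isVNPFamily {f : ∀ n, MvPolynomial (Fin (v n)) ℂ}
    (hf : IsVNPFamily f) : FormatSkeletons f :=
  formatSkeletons_of_isVNPnbFamily (hf.1.1.mono fun n => by simp) hf.isVNPnbFamily

/-- **`VNP^ℂ ⊆ BINARY`**: every `VNP` family over `ℂ` has a binary skeleton on polynomially many
slots (F1, `binarySkeletons_iff_formatSkeletons`). [cite: Burgisser2026HNC, Lemma 4.11 (p. 14)] -/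
theorem binarySkeletons_of_isVNPFamily {f : ∀ n, MvPolynomial (Fin (v n)) ℂ}
    (hf : IsVNPFamily f) : BinarySkeletons f :=
  (binarySkeletons_iff_formatSkeletons hf.1).2 (formatSkeletons_of_isVNPFamily hf)

/-- `VP^ℂ ⊆ BINARY` (`VP ⊆ VNP`). [cite: Burgisser2000, §2.1] -/
theorem binarySkeletons_of_isPComputable {f : ∀ n, MvPolynomial (Fin (v n)) ℂ}
    (hpf : IsPFamily f) (hc : IsPComputable f) : BinarySkeletons f :=
  binarySkeletons_of_isVNPFamily (IsVPFamily.isVNPFamily_holds' ⟨hpf, hc⟩)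

/-- **`¬BINARY ⟹ ¬U`**: a `\overline{VP}` p-family without binary skeleton lies outside `VNP`,
refuting `U = ClosureDefinable`. [cite: GrochowMulmuleyQiao2016, §1 (p. 3)] -/
theorem not_closureDefinable_of_noBinary {f : ∀ n, MvPolynomial (Fin (v n)) ℂ}
    (hpf : IsPFamily f) (hbar : IsVPBarFamily f) (h : ¬ BinarySkeletons f) :
    ¬ ClosureDefinable :=
  fun hU => h (binarySkeletons_of_isVNPFamily (hU v f hpf hbar))

/-- **`¬BINARY ⟹ M`**: the boundary of `VP` is nonempty. [cite: GrochowMulmuleyQiao2016, §1] -/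
theorem boundaryOfVPNonempty_of_noBinary {f : ∀ n, MvPolynomial (Fin (v n)) ℂ}
    (hpf : IsPFamily f) (hbar : IsVPBarFamily f) (h : ¬ BinarySkeletons f) :
    BoundaryOfVPNonempty :=
  boundaryOfVPNonempty_of_not_closureDefinable (not_closureDefinable_of_noBinary hpf hbar h)

/-- **`¬BINARY ⟹ Q`**: the residual `EmptyBoundarySeparates`. [cite: GrochowMulmuleyQiao2016, §1] -/
theorem emptyBoundarySeparates_of_noBinary {f : ∀ n, MvPolynomial (Fin (v n)) ℂ}
    (hpf : IsPFamily f) (hbar : IsVPBarFamily f) (h : ¬ BinarySkeletons f) :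
    EmptyBoundarySeparates :=
  q_of_not_closureDefinable (not_closureDefinable_of_noBinary hpf hbar h)

/-- Packaging of §4 + `VPBoundarySquareCaseSplit`, no new content: every `\overline{VP}` p-family
has a binary skeleton, or the boundary of `VP` is nonempty. [cite: GrochowMulmuleyQiao2016, §1] -/
theorem binarySkeletons_or_boundary :
    (∀ (v : ℕ → ℕ) (f : ∀ n, MvPolynomial (Fin (v n)) ℂ), IsPFamily f → IsVPBarFamily f →
      BinarySkeletons f) ∨ BoundaryOfVPNonempty := by
  by_cases hU : ClosureDefinable
  · exact Or.inl fun v f hpf hbar => binarySkeletons_of_isVNPFamily (hU v f hpf hbar)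
  · exact Or.inr (boundaryOfVPNonempty_of_not_closureDefinable hU)

end Summit.ValiantsHypothesis.ValiantsHypothesis.Theorems.VPBoundarySquareBinaryFormatVNP
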